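import Summits.KontsevichZagierPeriods.KontsevichZagierPeriods.Theses.HurwitzMicroSectors

/-!
# Okada's theorem, step (G): Galois conjugation of a rational relation among powers of `ζ_L`

If a `ℚ`-linear combination of powers of a primitive `L`-th root of unity `ζ` vanishes, then the same
combination of the powers of `ζ^t` vanishes for every `t` coprime to `L` (the minimal polynomial of
`ζ` over `ℚ` is the cyclotomic polynomial, shared by all primitive `L`-th roots). Applied to the
double sums `Σ_j Σ_u Λ(u) b_j ζ^{j·u}` this is the passage `Λ ↦ Λ(t⁻¹ ·)` ("twisting").
[folklore; Okada 1981]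
-/

noncomputable section

open Complex Polynomial
open scoped BigOperators

namespace Summit.KontsevichZagierPeriods.Theorems.HurwitzMicroSectorsHurwitzSectorComplement.Okada

/-- A rational polynomial vanishing at a primitive `L`-th root of unity vanishes at all of them:
`aeval ζ P = 0 → aeval (ζ ^ t) P = 0` for `t` coprime to `L`. [folklore] -/
theorem aeval_pow_eq_zero_of_coprime {L : ℕ} (hL : 0 < L) {ζ : ℂ} (hζ : IsPrimitiveRoot ζ L)
    (P : ℚ[X]) (hP : aeval ζ P = 0) {t : ℕ} (ht : t.Coprime L) : aeval (ζ ^ t) P = 0 := by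
  have hdvd : minpoly ℚ ζ ∣ P := minpoly.dvd ℚ ζ hP
  have h1 : minpoly ℚ ζ = minpoly ℚ (ζ ^ t) := by
    rw [← cyclotomic_eq_minpoly_rat hζ hL, ← cyclotomic_eq_minpoly_rat (hζ.pow_of_coprime t ht) hL]
  obtain ⟨Q, hQ⟩ := hdvd
  rw [hQ, map_mul, h1, minpoly.aeval, zero_mul]

/-- Powers of a primitive `L`-th root of unity only depend on the exponent modulo `L`. [folklore] -/
theorem pow_eq_pow_of_mod_eq {L : ℕ} {ζ : ℂ} (hζ : IsPrimitiveRoot ζ L) {m m' : ℕ}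
    (h : m % L = m' % L) : ζ ^ m = ζ ^ m' := by
  rw [← Nat.mod_add_div m L, ← Nat.mod_add_div m' L, pow_add, pow_add, pow_mul, pow_mul,
    hζ.pow_eq_one, one_pow, one_pow, h]

/-- **Step (G), twisting a vanishing double sum.** For `Λ : ZMod L → ℚ`, rational weights `b j` and
`ζ` a primitive `L`-th root of unity: if `Σ_{j<L} Σ_u Λ(u) b_j ζ^{j·u} = 0` then for every unit `t`,
`Σ_{j<L} Σ_u Λ(t⁻¹u) b_j ζ^{j·u} = 0`. [folklore] -/
theorem twist_doubleSum_eq_zero {L : ℕ} [NeZero L] {ζ : ℂ} (hζ : IsPrimitiveRoot ζ L)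
    (Λ : ZMod L → ℚ) (b : ℕ → ℚ)
    (h : ∑ j ∈ Finset.range L, ∑ u : ZMod L, ((Λ u * b j : ℚ) : ℂ) * ζ ^ (j * u.val) = 0)
    (t : (ZMod L)ˣ) :
    ∑ j ∈ Finset.range L, ∑ u : ZMod L,
      ((Λ (((t⁻¹ : (ZMod L)ˣ) : ZMod L) * u) * b j : ℚ) : ℂ) * ζ ^ (j * u.val) = 0 := by
  have hL : 0 < L := Nat.pos_of_ne_zero (NeZero.ne L)
  -- the relation as a rational polynomial identity `aeval ζ P = 0`
  set P : ℚ[X] := ∑ j ∈ Finset.range L, ∑ u : ZMod L, C (Λ u * b j) * X ^ (j * u.val) with hP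
  have haeval : ∀ z : ℂ, aeval z P = ∑ j ∈ Finset.range L, ∑ u : ZMod L,
      ((Λ u * b j : ℚ) : ℂ) * z ^ (j * u.val) := fun z => by
    simp only [hP, map_sum, map_mul, aeval_C, map_pow, aeval_X, eq_ratCast, Rat.cast_mul]
  have h0 : aeval ζ P = 0 := by rw [haeval, h]
  -- conjugate: `aeval (ζ^τ) P = 0`, `τ = val t`
  set τ : ℕ := ((t : ZMod L)).val with hτ
  have hcop : τ.Coprime L := ZMod.val_coe_unit_coprime t
  have h1 := aeval_pow_eq_zero_of_coprime hL hζ P h0 hcop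
  rw [haeval] at h1
  -- reindex `u ↦ t u`
  rw [← h1]
  refine Finset.sum_congr rfl fun j _ => ?_
  refine Fintype.sum_equiv (Units.mulLeft t⁻¹) _ _ fun u => ?_
  -- `u ↦ t⁻¹ u`; the exponents agree modulo `L`
  have hu : (t : ZMod L) * (((t⁻¹ : (ZMod L)ˣ) : ZMod L) * u) = u := by
    rw [← mul_assoc, Units.mul_inv, one_mul]
  have hval : (τ * (((t⁻¹ : (ZMod L)ˣ) : ZMod L) * u).val) % L = u.val := by
    have := congrArg ZMod.val hu
    rw [ZMod.val_mul] at this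
    rw [hτ]
    exact this
  show ((Λ (((t⁻¹ : (ZMod L)ˣ) : ZMod L) * u) * b j : ℚ) : ℂ) * ζ ^ (j * u.val) =
    ((Λ ((Units.mulLeft t⁻¹) u) * b j : ℚ) : ℂ) * (ζ ^ τ) ^ (j * ((Units.mulLeft t⁻¹) u).val)
  rw [Units.mulLeft_apply, ← pow_mul]
  congr 1
  refine pow_eq_pow_of_mod_eq hζ ?_
  conv_lhs => rw [← hval]
  rw [Nat.mul_mod, Nat.mod_mod, ← Nat.mul_mod]
  ring_nf

/-- **Step (G) of Okada's theorem, registered form** (explicit binders): twisting a vanishing rational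
double sum over powers of a primitive `L`-th root of unity by a unit `t`. [folklore] -/
theorem okada_stepG : ∀ (L : ℕ) [NeZero L] (ζ : ℂ), IsPrimitiveRoot ζ L → ∀ (Λ : ZMod L → ℚ) (b : ℕ → ℚ), (∑ j ∈ Finset.range L, ∑ u : ZMod L, ((Λ u * b j : ℚ) : ℂ) * ζ ^ (j * u.val) = 0) → ∀ (t : (ZMod L)ˣ), ∑ j ∈ Finset.range L, ∑ u : ZMod L, ((Λ (((t⁻¹ : (ZMod L)ˣ) : ZMod L) * u) * b j : ℚ) : ℂ) * ζ ^ (j * u.val) = 0 :=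
  fun _ _ _ hζ Λ b h t => twist_doubleSum_eq_zero hζ Λ b h t

end Summit.KontsevichZagierPeriods.Theorems.HurwitzMicroSectorsHurwitzSectorComplement.Okada

end
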